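import Mathlib
import Summits.ValiantsHypothesis.ValiantsHypothesis.Theorems.GrenetZeonTwoDimCoefficientsScalingClosureRank

/-!
# Crux `GrenetZeon.TwoDimCoefficients` (stmt-ValiantsHypothesis-8062), stub `stub_dualUnipotent`:
# scaling-closure — FIRST-ORDER RANK LEMMA (brick for the residual L1′, multiple shadow factors)

The residual L1′ of the scaling-closure method (memo SEVENTEENTH-HAND.md) is a Mignon–Ressayre bound for a REPEATED
factor `S` of the shadow `H = S^μ·G`: at a zero of `S` the Hessian of `H` itself degenerates to the rank-`≤ 1` matrix
`μ(μ−1)S^{μ−2}G·∇S∇Sᵀ`, and `Hess S` only appears at FIRST ORDER along the finite-`δ` deformation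
`F(z,t,δ) = det(A(z/δ) + tδⁿB(z/δ))` of `H`: on a branch of `Z(F)` through the zero one meets a one-parameter family of
matrices `M(τ) = u·wᵀ + τ·M₁ + O(τ²)` with `rank M(τ) ≤ 2m` (`τ ≠ 0`; Mignon–Ressayre at honest determinants) and
`M₁ = λ·Hess S + (∇S·vᵀ + v·∇Sᵀ)`.  The linear-algebra step that extracts `rank Hess S ≤ 2m + 3` from this is:

* `rank_map_eval_le_of_infinite` — GENERIC RANK BOUNDS SPECIALISE: a polynomial matrix `N ∈ F[τ]^{p×q}` with
  `rank N(s) ≤ r` for all `s` in an infinite set has `rank N(s₀) ≤ r` for every `s₀` (a non-vanishing minor at `s₀` is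
  a non-zero polynomial in `τ`).
* ★ `rank_coeff_one_le_of_coeff_zero_eq_vecMulVec` — FIRST-ORDER RANK LEMMA: `M ∈ F[τ]^{p×q}` with `rank M(s) ≤ r`
  on an infinite set and constant term `M(0) = u·wᵀ` has linear term of rank `≤ r + 1` (tight: `M = (1,τ)ᵀ(1,τ)`,
  `r = 1`, `[τ¹]M = e₁e₂ᵀ + e₂e₁ᵀ`).  Proof: kill `u` by `X = 1 − u·yᵀ` (`y·u = 1`); `X·M = τ·N`, `rank N(s) ≤ r` for
  `s ≠ 0`, specialise to `s = 0`: `rank (X·[τ¹]M) ≤ r`, and `[τ¹]M = X·[τ¹]M + u·(yᵀ[τ¹]M)`.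

HONEST FRAMING: generic linear algebra; the analytic part of L1′ (branch selection on `Z(F)`, Newton polygon of `F`
in `(ord_S, ord_δ)`) is NOT here; the stub `DualUnipotentBound`, both cruxes (stmt-8062, stmt-24318) and `VP ≠ VNP`
remain open.

References: folklore.
-/

-- single-conjunct layout `Summits/ValiantsHypothesis/ValiantsHypothesis`: the duplicated namespace
-- component is mandated by the tree.
set_option linter.dupNamespace false
set_option autoImplicit false

noncomputable section

namespace Summit.ValiantsHypothesis.ValiantsHypothesis.Theorems.GrenetZeonTwoDimCoefficients.ScalingClosure

open Matrix

section GenericRank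

variable {F : Type*} [Field F] {p q : Type*} [Fintype p] [Fintype q]

omit [Fintype p] [Fintype q] in
/-- Evaluation commutes with minors. [folklore] -/
theorem eval_det_submatrix (N : Matrix p q (Polynomial F)) {k : ℕ} (ρ : Fin k → p) (κ : Fin k → q) (s : F) :
    ((N.submatrix ρ κ).det).eval s = ((N.map (Polynomial.eval s)).submatrix ρ κ).det := by
  rw [← Polynomial.coe_evalRingHom, RingHom.map_det, RingHom.mapMatrix_apply, Matrix.submatrix_map]

/-- **Generic rank bounds specialise** (Zariski lower semicontinuity of rank, polynomial form). [folklore] -/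
theorem rank_map_eval_le_of_infinite (N : Matrix p q (Polynomial F)) {r : ℕ} {S : Set F} (hS : S.Infinite)
    (h : ∀ s ∈ S, (N.map (Polynomial.eval s)).rank ≤ r) (s₀ : F) :
    (N.map (Polynomial.eval s₀)).rank ≤ r := by
  classical
  by_contra hlt
  obtain ⟨ρ, κ, hρκ⟩ :=
    (succ_le_rank_iff_exists_det_submatrix_ne_zero (N.map (Polynomial.eval s₀)) r).mp (by omega)
  set P : Polynomial F := (N.submatrix ρ κ).det with hP
  have hP0 : P ≠ 0 := fun h0 => hρκ (by rw [← eval_det_submatrix, ← hP, h0, Polynomial.eval_zero])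
  obtain ⟨s, hsS, hs⟩ : ∃ s ∈ S, P.eval s ≠ 0 := by
    by_contra hall
    push Not at hall
    exact hP0 (Polynomial.eq_zero_of_infinite_isRoot P (hS.mono fun s hs => hall s hs))
  have hle := (succ_le_rank_iff_exists_det_submatrix_ne_zero (N.map (Polynomial.eval s)) r).mpr
    ⟨ρ, κ, by rwa [← eval_det_submatrix]⟩
  exact absurd (h s hsS) (by omega)

end GenericRank

section FirstOrder

variable {F : Type*} [Field F] {p q : Type*} [Fintype p] [Fintype q] [DecidableEq p]

omit [Fintype p] [DecidableEq p] in
/-- Subadditivity of matrix rank (any field). [folklore] -/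
theorem matrix_rank_add_le [DecidableEq q] (A B : Matrix p q F) : (A + B).rank ≤ A.rank + B.rank := by
  unfold Matrix.rank
  rw [Matrix.mulVecLin_add]
  exact (Submodule.finrank_mono (LinearMap.range_add_le _ _)).trans
    (Submodule.finrank_add_le_finrank_add_finrank _ _)

omit [Fintype p] [Fintype q] [DecidableEq p] in
/-- A polynomial matrix with vanishing constant terms is `τ` times its `divX`. [folklore] -/
theorem map_eval_eq_smul_of_coeff_zero_eq_zero (M : Matrix p q (Polynomial F))
    (h0 : ∀ i j, (M i j).coeff 0 = 0) (s : F) :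
    M.map (Polynomial.eval s) = s • (M.map Polynomial.divX).map (Polynomial.eval s) := by
  ext i j
  rw [Matrix.map_apply, Matrix.smul_apply, Matrix.map_apply, Matrix.map_apply, smul_eq_mul]
  conv_lhs => rw [← Polynomial.divX_mul_X_add (M i j), h0 i j, map_zero, add_zero]
  rw [Polynomial.eval_mul, Polynomial.eval_X, mul_comm]

/-- ★ **First-order rank lemma.**  `M ∈ F[τ]^{p×q}` with `rank M(s) ≤ r` for all `s` in an infinite set and
constant term `M(0) = u·wᵀ`: the linear term `[τ¹]M` has rank `≤ r + 1`. [folklore] -/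
theorem rank_coeff_one_le_of_coeff_zero_eq_vecMulVec (M : Matrix p q (Polynomial F)) {r : ℕ} {S : Set F}
    (hS : S.Infinite) (h : ∀ s ∈ S, (M.map (Polynomial.eval s)).rank ≤ r) (u : p → F) (w : q → F)
    (h0 : M.map (fun f => f.coeff 0) = vecMulVec u w) :
    (M.map (fun f => f.coeff 1)).rank ≤ r + 1 := by
  classical
  -- a row operator `X` with `X u = 0` and `1 - X` of rank `≤ 1`
  obtain ⟨y, X, hXu, hX1⟩ : ∃ (y : p → F) (X : Matrix p p F), X *ᵥ u = 0 ∧ X + vecMulVec u y = 1 := by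
    by_cases hu : u = 0
    · exact ⟨0, 1, by simp [hu], by simp [hu]⟩
    · obtain ⟨i, hi⟩ : ∃ i, u i ≠ 0 := by
        by_contra hall; push Not at hall; exact hu (funext hall)
      refine ⟨Pi.single i (u i)⁻¹, 1 - vecMulVec u (Pi.single i (u i)⁻¹), ?_, by abel⟩
      have hyu : Pi.single i (u i)⁻¹ ⬝ᵥ u = 1 := by
        rw [dotProduct_comm, dotProduct_single, mul_inv_cancel₀ hi]
      rw [sub_mulVec, one_mulVec, vecMulVec_mulVec, hyu, MulOpposite.op_one, one_smul, sub_self]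
  set M₁ : Matrix p q F := M.map (fun f => f.coeff 1) with hM₁
  set M' : Matrix p q (Polynomial F) := X.map Polynomial.C * M with hM'
  -- `M'` has vanishing constant terms and linear term `X * M₁`
  have hcoeff : ∀ (k : ℕ) i j, (M' i j).coeff k = ∑ l, X i l * (M l j).coeff k := by
    intro k i j
    rw [hM', Matrix.mul_apply, Polynomial.finsetSum_coeff]
    refine Finset.sum_congr rfl fun l _ => ?_
    rw [Matrix.map_apply, Polynomial.coeff_C_mul]
  have h0' : ∀ i j, (M' i j).coeff 0 = 0 := by
    intro i j
    rw [hcoeff]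
    have hrow : ∑ l, X i l * (M l j).coeff 0 = (X * vecMulVec u w) i j := by
      rw [Matrix.mul_apply]; refine Finset.sum_congr rfl fun l _ => ?_; rw [← h0]; rfl
    rw [hrow, mul_vecMulVec, hXu]
    simp [vecMulVec_apply]
  have h1' : (M'.map Polynomial.divX).map (Polynomial.eval 0) = X * M₁ := by
    ext i j
    rw [Matrix.map_apply, Matrix.map_apply, ← Polynomial.coeff_zero_eq_eval_zero, Polynomial.coeff_divX,
      zero_add, hcoeff, Matrix.mul_apply]
    rfl
  -- `rank N(s) ≤ r` for `s ∈ S \\ {0}`, `N = M'.divX`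
  have hN : ∀ s ∈ S \ {0}, ((M'.map Polynomial.divX).map (Polynomial.eval s)).rank ≤ r := by
    rintro s ⟨hsS, hs0⟩
    have hs0' : s ≠ 0 := hs0
    have hMs : M'.map (Polynomial.eval s) = X * M.map (Polynomial.eval s) := by
      rw [hM', ← Polynomial.coe_evalRingHom, Matrix.map_mul, Matrix.map_map]
      congr 1
      ext i j; simp
    have hsmul := map_eval_eq_smul_of_coeff_zero_eq_zero M' h0' s
    have hNs : (M'.map Polynomial.divX).map (Polynomial.eval s) = (s⁻¹ • X) * M.map (Polynomial.eval s) := by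
      rw [Matrix.smul_mul, ← hMs, hsmul, smul_smul, inv_mul_cancel₀ hs0', one_smul]
    rw [hNs]
    exact (Matrix.rank_mul_le_right _ _).trans (h s hsS)
  have hXM₁ : (X * M₁).rank ≤ r := by
    rw [← h1']
    exact rank_map_eval_le_of_infinite _ (hS.sdiff (Set.finite_singleton 0)) hN 0
  -- `M₁ = X M₁ + u (yᵀ M₁)`
  have hsplit : M₁ = X * M₁ + vecMulVec u y * M₁ := by rw [← Matrix.add_mul, hX1, Matrix.one_mul]
  calc M₁.rank = (X * M₁ + vecMulVec u y * M₁).rank := by rw [← hsplit]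
    _ ≤ (X * M₁).rank + (vecMulVec u y * M₁).rank := matrix_rank_add_le _ _
    _ ≤ r + 1 := Nat.add_le_add hXM₁ ((Matrix.rank_mul_le_left _ _).trans (Matrix.rank_vecMulVec_le _ _))

end FirstOrder

end Summit.ValiantsHypothesis.ValiantsHypothesis.Theorems.GrenetZeonTwoDimCoefficients.ScalingClosure

end
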